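import Summits.ResolutionOfSingularities.ResolutionOfSingularities.Theorems.PurelyInseparableDim4ChartAtlasReading
import Literature.AlgebraicGeometry.Resolution.BlowupSequencesExtendOpen
import Literature.AlgebraicGeometry.Resolution.BlowupSequencesLocalIsoDescent
import Literature.AlgebraicGeometry.Resolution.BoundaryEquivalence
import HarnessLib

/-!
# ATLAS GLUE: admissibility of a centre from an open cover by charts — simple normal crossings and regularity are local
# (brick S3-N1/S3-N2 support for typ-3's joint forest v3; cell `res-dim4-pi`, typ-2 g5)

[OURS · counted 0] (D-0157 DOOR 2; DR-157-C; desk WORD #115 (a) (S3-N1 «multi-chart member format»); typ-3 g4 `S3c-V3-DESIGN.md`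
«a member carries a finite ATLAS of zigzag charts … Regularity / snc / ⊆ supp are GLOBAL hypotheses on `c`»). For a v3 member
covered by several charts `φ_α : Y_α → X'` (open immersions), the global admissibility hypotheses of BGMW Def. 3.1.3 must be
ASSEMBLED from chart readings. PROVED here (no `sorry`, no new axiom), for any scheme `X`, any boundary `E`, any centre `C`:

* **`hasSNCWith_of_cover_comap`** — if `E` has simple normal crossings on `X` (`HasSNC E`), the support of `C` is covered by
  the ranges of open immersions `φ i : U i → X`, and on every chart `HasSNCWith (E.map (·.comap (φ i))) (C.comap (φ i))`, then
  **`HasSNCWith E C`** (the regular system of parameters adapted to the chart data transports along `𝒪_{X, φ x'} ≅ 𝒪_{U, x'}`;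
  distinct boundary members through a point have distinct stalks, `HasSNCWith.injOn_stalkIdeal`);
* **`isRegular_subscheme_of_cover_comap`** — if the support of `C` is covered by the ranges of the `φ i` and every
  `V(C.comap (φ i))` is regular, then **`V(C)` is regular**;
* `support_subset_of_cover_comap` — `V(C) ⊆ supp M` from the chart-wise inclusions `V(C.comap φᵢ) ⊆ (φᵢ)⁻¹ supp M`.

USE: with the S3-N1 atlas (`…ChartAtlasPackage`, `…ChartAtlasInsidePackage`: cover + per-chart readings) and the chart-level
S3-N2 criterion (`…ChartAtlasSNCObstruction` / `…SNCCriterion`), these give the GLOBAL admissibility of an escaping member at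
any depth from chart data — or refute it. Nothing here is a statement about resolution of singularities in dimension ≥ 4 /
characteristic `p` (NOT proved anywhere in this programme). bears_on: LADDER-RESOLUTION:D157-DOOR2 (res-dim4-pi). Supports
stmt-ResolutionOfSingularities-16155 (helper, S3-N1/N2 glue).
-/

-- every declaration of this summit lives under `Summit.ResolutionOfSingularities.ResolutionOfSingularities`
-- (summit = problem), which the duplicate-namespace linter flags; house convention (cf. the Target file).
set_option linter.dupNamespace false

noncomputable section

open CategoryTheory CategoryTheory.Limits AlgebraicGeometry Opposite TopologicalSpace IsLocalRing
open AlgebraicGeometry.Scheme.IdealSheafData (ofIdealTop vanishingIdeal)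

namespace Summit.ResolutionOfSingularities.ResolutionOfSingularities.Theorems.PIDim4

open Literature.AlgebraicGeometry.Resolution

namespace ChartDictionary

universe u

variable {X : Scheme.{u}} {ι : Type*} {U : ι → Scheme.{u}} (φ : ∀ i, U i ⟶ X) [∀ i, IsOpenImmersion (φ i)]

/-! ## §1 Simple normal crossings with the centre are local on a cover of the centre -/

/-- **SNC WITH A CENTRE IS LOCAL ON A COVER OF THE CENTRE BY CHARTS.** `E` snc on `X`, `V(C) ⊆ ⋃ᵢ range φᵢ` for open
immersions `φᵢ`, and `HasSNCWith (φᵢ^* E) (φᵢ^* C)` for every `i` ⇒ `HasSNCWith E C`. -/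
theorem hasSNCWith_of_cover_comap {E : List X.IdealSheafData} {C : X.IdealSheafData} (hE : HasSNC E)
    (hcov : (C.support : Set X) ⊆ ⋃ i, Set.range (φ i))
    (h : ∀ i, HasSNCWith (E.map (·.comap (φ i))) (C.comap (φ i))) : HasSNCWith E C := by
  classical
  intro y
  by_cases hy : y ∈ C.support
  swap
  · obtain ⟨hreg, w, hw, hι, -⟩ := hE y
    exact ⟨hreg, w, hw, hι, fun h => absurd h hy⟩
  obtain ⟨i, x', rfl⟩ := Set.mem_iUnion.mp (hcov hy)
  obtain ⟨hreg', u', hu', ⟨ι', hι', hι'D⟩, hC'⟩ := h i x'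
  haveI := hreg'
  set e := stalkEquivOfIsLocalIso (φ i) x' with he_def
  haveI hreg : IsRegularLocalRing (X.presheaf.stalk (φ i x')) := IsRegularLocalRing.of_ringEquiv e.symm
  refine ⟨hreg, ?_⟩
  -- the embedding dimensions agree
  have hrank : (maximalIdeal (X.presheaf.stalk (φ i x'))).spanFinrank =
      (maximalIdeal ((U i).presheaf.stalk x')).spanFinrank := by
    rw [← map_ringEquiv_maximalIdeal e, Ideal.spanFinrank_map_eq_of_ringEquiv]
  let σ : Fin (maximalIdeal (X.presheaf.stalk (φ i x'))).spanFinrank ≃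
      Fin (maximalIdeal ((U i).presheaf.stalk x')).spanFinrank := finCongr hrank
  let u : Fin (maximalIdeal (X.presheaf.stalk (φ i x'))).spanFinrank → X.presheaf.stalk (φ i x') :=
    fun k => e.symm (u' (σ k))
  have huσ : ∀ k, u (σ.symm k) = e.symm (u' k) := fun k => by
    simp only [u, Equiv.apply_symm_apply]
  refine ⟨u, ?_, ?_, ?_⟩
  · -- `(u) = 𝔪`
    have hr : Set.range u = e.symm '' Set.range u' := by
      rw [show u = (fun k => e.symm (u' k)) ∘ σ from rfl, σ.surjective.range_comp]
      exact Set.range_comp _ u'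
    rw [hr, ← Ideal.map_span e.symm, hu', map_ringEquiv_maximalIdeal]
  · -- the boundary components through `φ i x'`
    let θ : {D // D ∈ E ∧ φ i x' ∈ D.support} → {D' // D' ∈ E.map (·.comap (φ i)) ∧ x' ∈ D'.support} :=
      fun D => ⟨D.1.comap (φ i), List.mem_map.mpr ⟨D.1, D.2.1, rfl⟩, by
        rw [Scheme.IdealSheafData.support_comap]; exact D.2.2⟩
    have hθ : Function.Injective θ := by
      intro D₁ D₂ hD
      have h1 : D₁.1.comap (φ i) = D₂.1.comap (φ i) := congrArg Subtype.val hD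
      have h2 : stalkIdeal D₁.1 (φ i x') = stalkIdeal D₂.1 (φ i x') := by
        rw [stalkIdeal_eq_map_symm_of_isLocalIso (φ i) D₁.1, stalkIdeal_eq_map_symm_of_isLocalIso (φ i) D₂.1, h1]
      exact Subtype.ext (hE.injOn_stalkIdeal (φ i x') D₁.1 D₁.2.1 D₂.1 D₂.2.1 D₁.2.2 D₂.2.2 h2)
    refine ⟨fun D => σ.symm (ι' (θ D)), fun D₁ D₂ heq => hθ (hι' (σ.symm.injective heq)), ?_⟩
    intro D
    rw [huσ, stalkIdeal_eq_map_symm_of_isLocalIso (φ i), ← he_def,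
      show stalkIdeal (D.1.comap (φ i)) x' = Ideal.span {u' (ι' (θ D))} from hι'D (θ D), Ideal.map_span,
      Set.image_singleton]
  · -- the centre
    intro _
    have hx' : x' ∈ (C.comap (φ i)).support := by
      rw [Scheme.IdealSheafData.support_comap]; exact hy
    obtain ⟨S, hS⟩ := hC' hx'
    refine ⟨σ ⁻¹' S, ?_⟩
    rw [stalkIdeal_eq_map_symm_of_isLocalIso (φ i), ← he_def, hS, Ideal.map_span, Set.image_image]
    congr 1
    rw [show u = (fun k => e.symm (u' k)) ∘ σ from rfl, Set.image_comp, σ.image_preimage]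

/-! ## §2 Regularity of the centre is local on a cover of the centre by charts -/

/-- **REGULARITY OF `V(C)` IS LOCAL ON A COVER BY CHARTS**: `V(C) ⊆ ⋃ᵢ range φᵢ` and every `V(φᵢ^* C)` regular ⇒ `V(C)` regular
(`V(φᵢ^* C) = V(C) ×_X Uᵢ → V(C)` is a local isomorphism onto the part over `range φᵢ`). -/
theorem isRegular_subscheme_of_cover_comap {C : X.IdealSheafData} (hcov : (C.support : Set X) ⊆ ⋃ i, Set.range (φ i))
    (h : ∀ i, Scheme.IsRegular (C.comap (φ i)).subscheme) : Scheme.IsRegular C.subscheme := by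
  intro z
  have hz : C.subschemeι z ∈ (C.support : Set X) := by
    rw [← Scheme.IdealSheafData.range_subschemeι]; exact ⟨z, rfl⟩
  obtain ⟨i, x', hx'⟩ := Set.mem_iUnion.mp (hcov hz)
  -- `z` is in the range of the local isomorphism `V(C) ×_X U i → V(C)`
  have h' : Scheme.IsRegular (pullback (φ i) C.subschemeι) := (h i).of_iso (C.comapIso (φ i)).hom
  haveI : IsLocalIso (pullback.snd (φ i) C.subschemeι) := MorphismProperty.pullback_snd _ _ inferInstance
  have hzr : z ∈ Set.range (pullback.snd (φ i) C.subschemeι) := by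
    rw [Scheme.Pullback.range_snd]
    exact ⟨x', hx'⟩
  obtain ⟨w, rfl⟩ := hzr
  haveI := h' w
  exact IsRegularLocalRing.of_ringEquiv (stalkEquivOfIsLocalIso (pullback.snd (φ i) C.subschemeι) w).symm

/-! ## §3 The support condition is local (set theory) -/

omit [∀ i, IsOpenImmersion (φ i)] in
/-- `V(C) ⊆ T` from the chart-wise inclusions `V(φᵢ^* C) ⊆ φᵢ⁻¹ T` and the cover. -/
theorem support_subset_of_cover_comap {C : X.IdealSheafData} {T : Set X}
    (hcov : (C.support : Set X) ⊆ ⋃ i, Set.range (φ i))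
    (h : ∀ i, ((C.comap (φ i)).support : Set (U i)) ⊆ (φ i) ⁻¹' T) : (C.support : Set X) ⊆ T := by
  intro y hy
  obtain ⟨i, x', rfl⟩ := Set.mem_iUnion.mp (hcov hy)
  have hx' : x' ∈ ((C.comap (φ i)).support : Set (U i)) := by
    rw [Scheme.IdealSheafData.support_comap]; exact hy
  exact h i hx'

end ChartDictionary

end Summit.ResolutionOfSingularities.ResolutionOfSingularities.Theorems.PIDim4

end
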